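import Summits.QuantumFields.YangMills.Theorems.BalabanUVNodesN07EmapOfRecordTraceSectors
import Summits.QuantumFields.YangMills.Theorems.BalabanUVNodesN07W23OfRecordRealSlice
import HarnessLib

/-!
# NODE N07 — THE TRANSPOSED CURRENTS AND PRINT'S `Δ_π`-LETTER VS THE TRACE SECTORS: the trace of `(MᵗK)(b)` is `Σ_{b′} tr(K(b′)·(M δ_b1)(b′))`, so `MᵗK` is TRACELESS-valued
# whenever `M` kills the scalar direction `δ_b·1` (`M = D(HD)(A′)`, `D(HD₃)(A′)`) and has the traces of `K` when `M` fixes it (`M = DT(A′)`); def-Y's `Δπ := DeltaPiCurOfRecord`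
# maps traceless-presented jets to traceless currents; hence (85) `W₁(A′)`, (89) `W₃(A′)` are TRACELESS at every `N` and (88) `W₂(A′)` at `N = 2` — the `Δ_π`∕transpose part of the
# trace half of the «`W` maps `evHerm0` to `TZ`» ROW of def-Y's ✓`Node00.BgSchemeChartLie.lieTokAt_of_rows` ([15] (27) p. 282, (85)–(89) p. 291, (51) p. 286; [B9] (3.119) p. 419)

Cell `pub-ymgap`, width seat `pub-ymgap-dag-n07-w3` (g27), CLAIM-4.  `--kind proof --supports stmt-QuantumFields-27238 --as helper`; count-neutral.
[15] = [Balaban1985Variational]; [B9] = [Balaban1985BackgroundPropagators].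

CONTENTS (`S := scalPartW N _`).
* §1 `scalPartW_starW` (`S` commutes with the bondwise conjugation), `scalPartW_realConj`, `scalPartW_btrans` (the bilinear transpose `Tᵗ = (⋆T⋆)†` of an `S`-commuting `T` commutes with `S`).
* §2 `scalPartW_hessOpOfRecordPiT` (`πᵗΔπ` commutes with `S` for commuting `G′`, `Δ(U₀)`), ★`trace_DeltaPiCurOfRecord_eq_zero` (any `N`, `Δ(U₀)` displayed) ∕ `_two` (`N = 2`).
* §3 `trace_transCur_apply` (the trace formula), `trace_transCur_apply_eq_zero_of_apply_single`, `trace_transCur_apply_of_apply_single_eq_self`, `slProjLit_single115_one`.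
* §4 at def-Y's letters (`‖A′‖ < a_C`; Sect. C regime ∕ `Prop4Hyp` displayed): ★★`trace_W1OfRecord_eq_zero` (ANY `N`, any `J`: `D(HD₃)(A′)` kills `δ_b·1`, ✓`fderiv_E3OfRecord_apply_eq_zero`),
  ★★`trace_W3OfRecord_eq_zero` (any `N`), `trace_W2OfRecord_eq_zero` (any `N`; `HD(A′)` traceless-presented and `Δ(U₀)` commuting displayed), ★★`trace_W2OfRecord_eq_zero_two` (`N = 2`,
  Hermitian traceless `A′`; `hCreal`, `hCtr` displayed, ✓`trace_equiv_EmapOfRecord_eq_zero_two`).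

HONEST LABELS.  Linear `*`-algebra plus the fixed-point ∕ blind-direction facts of ✓`…N07EmapOfRecordTraceSectors`; no estimate; regime letters displayed.  The `V₀`-group `curV0full` of
(90)–(96) and the assembled `W` are NOT here.  Count-neutral; N07 NOT discharged; P0 ⟨26900⟩ OPEN; R4 is the conditional finite-𝕋⁴ rung only.  Nothing here is a claim about the
Yang–Mills mass gap (`Summit.QuantumFields`): finite torus, fixed `ε`; nothing continuum ∕ OS ∕ Clay.
-/

set_option autoImplicit false

noncomputable section

open scoped Matrix Matrix.Norms.L2Operator InnerProductSpace ComplexConjugate BigOperators Topology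

namespace Summit.QuantumFields.YangMills.Theorems.N07W23OfRecordTraceSectors

open Filter Metric
open Literature.MathematicalPhysics.QuantumFieldTheory.Balaban1983to89
open Literature.MathematicalPhysics.QuantumFieldTheory.Balaban1983to89.T4Continuum (T4Family)
open T4Continuum BlockAveraging
open B9SectCLatticeCarrier (Bond)
open B9Eq311L2Pairing (WL2)
open B9Eq311TracePairing (starW equiv_starW apply_equiv_starW starW_starW realConj realConj_apply btrans)
open B9Eq3119DeltaPiCarrier (deltaPi currentCLM equiv_currentCLM)
open B11Eq103H1Complex (SiteL2K BondL2K funEquiv)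
open B11Eq111FrakG (nabla115)
open B11Eq115Space (NegSize NegSup levWeight JetSup)
open B11Eq90Transpose (transCur transCur_apply colFun_apply single115 flat115_single115)
open B11Eq90V0primeCurrent (flat115 flat115_apply)
open B11Eq80Current (Emap E3 W1 W2 W3)
open B11Eq90V0GroupComposed (T47)
open B11Eq174Chart (Regime)
open B11Prop6Scheme (Prop4Hyp)
open Node00
open Summit.QuantumFields.YangMills.Theorems.N07TraceSectorDefs (scalPartW equiv_scalPartW phiRec_equiv_scalPartW)
open Summit.QuantumFields.YangMills.Theorems.N07TraceSectorProjection (scalPartW_isSymmetric scalPartW_comp_hessOpOfRecord_two)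
open Summit.QuantumFields.YangMills.Theorems.N07H1OfRecordTraceSectors (adjoint_map_comm_of_isSymmetric)
open Summit.QuantumFields.YangMills.Theorems.N07FrakGOfRecordTraceSectors (traceless_of_comm traceless_funEquiv_symm)
open Summit.QuantumFields.YangMills.Theorems.N07SlotCTraceSectors (scalPartW_piOfRecord)
open Summit.QuantumFields.YangMills.Theorems.N07CslOfRecordTraceSectors (slProjLit_eq_zero_of_scalar)
open Summit.QuantumFields.YangMills.Theorems.N07EmapOfRecordTraceSectors (fderiv_EmapOfRecord_apply_eq_zero fderiv_E3OfRecord_apply_eq_zero trace_equiv_EmapOfRecord_eq_zero_two)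

/-! ## §1  The scalar part commutes with conjugation, real conjugates and bilinear transposes -/

section Fibre

variable (N : ℕ) {ι : Type*} (w : ι → ℝ) {ι' : Type*} (w' : ι' → ℝ)

/-- **`S(fᴴ) = (Sf)ᴴ`**: the scalar part commutes with the bondwise conjugation (`tr(Xᴴ) = conj tr X`). [cite: Balaban1985BackgroundPropagators, p.391 (bookkeeping)] -/
theorem scalPartW_starW (f : WL2 ℂ w (WRec N)) : scalPartW N w (starW (phiRec N) f) = starW (phiRec N) (scalPartW N w f) := by
  apply (WL2.equiv ℂ w (WRec N)).injective
  funext i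
  rw [equiv_scalPartW, apply_equiv_starW, equiv_starW, phiRec_equiv_scalPartW, star_smul, star_one, Matrix.star_eq_conjTranspose, Matrix.trace_conjTranspose,
    Complex.star_def, map_mul, map_inv₀, map_natCast]

/-- **The real conjugate `⋆T⋆` of an `S`-commuting `T` commutes with `S`.** [cite: Balaban1985BackgroundPropagators, p.390 (bookkeeping)] -/
theorem scalPartW_realConj {T : WL2 ℂ w (WRec N) →ₗ[ℂ] WL2 ℂ w' (WRec N)} (hT : ∀ x, T (scalPartW N w x) = scalPartW N w' (T x)) (f : WL2 ℂ w (WRec N)) :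
    realConj (phiRec N) T (scalPartW N w f) = scalPartW N w' (realConj (phiRec N) T f) := by
  rw [realConj_apply, realConj_apply, ← scalPartW_starW, hT, scalPartW_starW]

variable [Fintype ι] [Fintype ι'] [Fact (∀ i, 0 < w i)] [Fact (∀ i, 0 < w' i)]

/-- **The bilinear transpose `Tᵗ = (⋆T⋆)†` of an `S`-commuting `T` commutes with `S`** (`S` symmetric on both carriers, ✓`adjoint_map_comm_of_isSymmetric`).
[cite: Balaban1985BackgroundPropagators, (3.9) p.392, (3.119) p.419] -/
theorem scalPartW_btrans [NeZero N] {T : WL2 ℂ w (WRec N) →ₗ[ℂ] WL2 ℂ w' (WRec N)} (hT : ∀ x, T (scalPartW N w x) = scalPartW N w' (T x)) (g : WL2 ℂ w' (WRec N)) :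
    btrans (phiRec N) T (scalPartW N w' g) = scalPartW N w (btrans (phiRec N) T g) := by
  unfold btrans
  exact adjoint_map_comm_of_isSymmetric _ (scalPartW_isSymmetric N w) (scalPartW_isSymmetric N w') (scalPartW_realConj N w w' hT) g

end Fibre

/-! ## §2  Print's `Δ_π` letter of record maps traceless-presented jets to traceless currents -/

section DeltaPi

variable (F : T4Family) (N : ℕ) [NeZero N] (K : ℕ) (k : ℕ) (Ω : ℕ → Set (Site (F.P K) 0)) (U₀ : GaugeField (F.P K) 0 (SU N))
  [Fact (0 < (F.L : ℝ))] [Fact (0 < (F.P K).eta k)] [Fact (0 < c0Rec F K k)]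
  {Gp : SiteL2K ℂ (F.P K).d (fun _ => (F.P K).sitesPerDir 0) (c0Rec F K k) (WRec N) →ₗ[ℂ]
    SiteL2K ℂ (F.P K).d (fun _ => (F.P K).sitesPerDir 0) (c0Rec F K k) (WRec N)}

omit [Fact (0 < (F.L : ℝ))] [Fact (0 < (F.P K).eta k)] in
set_option maxRecDepth 16384 in
/-- **`πᵗ Δ(U₀) π` COMMUTES WITH `S`** for `G′` and `Δ(U₀)` commuting with `S` (✓`scalPartW_piOfRecord`, §1). [cite: Balaban1985BackgroundPropagators, (3.119) p.419; Balaban1985Variational, (51) p.286] -/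
theorem scalPartW_hessOpOfRecordPiT (hGp : ∀ s, Gp (scalPartW N _ s) = scalPartW N _ (Gp s))
    (hΔ : ∀ x, hessOpOfRecord F N k U₀ (scalPartW N _ x) = scalPartW N _ (hessOpOfRecord F N k U₀ x))
    (x : BondL2K ℂ (F.P K).d (fun _ => (F.P K).sitesPerDir 0) (c0Rec F K k) (WRec N)) :
    hessOpOfRecordPiT F N k U₀ Gp (QflatOfRecord F N k) (scalPartW N _ x) = scalPartW N _ (hessOpOfRecordPiT F N k U₀ Gp (QflatOfRecord F N k) x) := by
  have hπ := scalPartW_piOfRecord F N k U₀ hGp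
  unfold hessOpOfRecordPiT deltaPi
  rw [LinearMap.comp_apply, LinearMap.comp_apply, LinearMap.comp_apply, LinearMap.comp_apply, hπ, hΔ, scalPartW_btrans N _ _ hπ]

set_option maxRecDepth 16384 in
/-- ★ **def-Y's `Δπ = DeltaPiCurOfRecord G′ Q′♭` MAPS TRACELESS-PRESENTED JETS TO TRACELESS CURRENTS** (any `N`; `G′`, `Δ(U₀)` commuting with `S` displayed).
[cite: Balaban1985Variational, (80) p.290, (88)–(89) p.291, (51) p.286; Balaban1985BackgroundPropagators, (3.119) p.419] -/
theorem trace_DeltaPiCurOfRecord_eq_zero (hGp : ∀ s, Gp (scalPartW N _ s) = scalPartW N _ (Gp s))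
    (hΔ : ∀ x, hessOpOfRecord F N k U₀ (scalPartW N _ x) = scalPartW N _ (hessOpOfRecord F N k U₀ x)) {Y : Space115Lit F N K k Ω U₀}
    (hY : ∀ b, (JetSup.equiv _ _ (nabla115 ((F.P K).eta k) (unitsOfRecord F N U₀)) Y b).trace = 0) (b : Bond (F.P K).d (fun _ => (F.P K).sitesPerDir 0)) :
    (NegSup.equiv (levWeight (F.L : ℝ) ((F.P K).eta k) (bondLevLit F Ω k) 3) (Matrix (Fin N) (Fin N) ℂ) (DeltaPiCurOfRecord F N K k Ω U₀ Gp (QflatOfRecord F N k) Y) b).trace = 0 := by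
  have hY' : ∀ b, (flat115 Y b).trace = 0 := fun b => by rw [flat115_apply]; exact hY b
  have hT := scalPartW_hessOpOfRecordPiT F N K k U₀ hGp hΔ
  unfold DeltaPiCurOfRecord
  rw [equiv_currentCLM]
  refine traceless_of_comm N _ _ hT (fun i => ?_) b
  exact traceless_funEquiv_symm N _ hY' i

end DeltaPi

section DeltaPiTwo

variable (F : T4Family) (K : ℕ) (k : ℕ) (Ω : ℕ → Set (Site (F.P K) 0)) (U₀ : GaugeField (F.P K) 0 (SU 2))
  [Fact (0 < (F.L : ℝ))] [Fact (0 < (F.P K).eta k)] [Fact (0 < c0Rec F K k)]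
  {Gp : SiteL2K ℂ (F.P K).d (fun _ => (F.P K).sitesPerDir 0) (c0Rec F K k) (WRec 2) →ₗ[ℂ]
    SiteL2K ℂ (F.P K).d (fun _ => (F.P K).sitesPerDir 0) (c0Rec F K k) (WRec 2)}

set_option maxRecDepth 16384 in
/-- ★ **`N = 2`: `Δπ Y` IS TRACELESS for traceless-presented `Y`** and `G′` commuting with `S` (`Δ(U₀)` commutes by ✓`scalPartW_comp_hessOpOfRecord_two`).
[cite: Balaban1985Variational, (88)–(89) p.291, (51) p.286; Balaban1985BackgroundPropagators, (3.119) p.419] -/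
theorem trace_DeltaPiCurOfRecord_eq_zero_two (hGp : ∀ s, Gp (scalPartW 2 _ s) = scalPartW 2 _ (Gp s)) {Y : Space115Lit F 2 K k Ω U₀}
    (hY : ∀ b, (JetSup.equiv _ _ (nabla115 ((F.P K).eta k) (unitsOfRecord F 2 U₀)) Y b).trace = 0) (b : Bond (F.P K).d (fun _ => (F.P K).sitesPerDir 0)) :
    (NegSup.equiv (levWeight (F.L : ℝ) ((F.P K).eta k) (bondLevLit F Ω k) 3) (Matrix (Fin 2) (Fin 2) ℂ) (DeltaPiCurOfRecord F 2 K k Ω U₀ Gp (QflatOfRecord F 2 k) Y) b).trace = 0 := by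
  have hY' : ∀ b, (flat115 Y b).trace = 0 := fun b => by rw [flat115_apply]; exact hY b
  have hT := scalPartW_hessOpOfRecordPiT F 2 K k U₀ hGp (fun x => (LinearMap.congr_fun (scalPartW_comp_hessOpOfRecord_two F K k U₀) x).symm)
  unfold DeltaPiCurOfRecord
  rw [equiv_currentCLM]
  refine traceless_of_comm 2 _ _ hT (fun i => ?_) b
  exact traceless_funEquiv_symm 2 _ hY' i

end DeltaPiTwo

/-! ## §3  The trace of a transposed current -/

section Trans

variable (F : T4Family) (N : ℕ) (K : ℕ) (k : ℕ) (Ω : ℕ → Set (Site (F.P K) 0)) (U₀ : GaugeField (F.P K) 0 (SU N))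
  [Fact (0 < (F.L : ℝ))] [Fact (0 < (F.P K).eta k)]

/-- **THE TRACE OF A TRANSPOSED CURRENT AT A BOND**: `tr (MᵗK)(b) = Σ_{b′} tr(K(b′)·(M δ_b1)(b′))` (`tr ρ(ℓ) = ℓ(1)` by the dualising identity ✓`tauRecCLM_rhoRec_mul`).
[cite: Balaban1985Variational, (27) p.282, (85) p.291, (90) p.291] -/
theorem trace_transCur_apply (M : Space115Lit F N K k Ω U₀ →L[ℂ] Space115Lit F N K k Ω U₀) (Kc : NegSizeLit F N K k Ω 3) (b : Bond (F.P K).d (fun _ => (F.P K).sitesPerDir 0)) :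
    (NegSup.equiv (levWeight (F.L : ℝ) ((F.P K).eta k) (bondLevLit F Ω k) 3) (Matrix (Fin N) (Fin N) ℂ) (transCur (rhoRec N) (tauRecCLM N) M Kc) b).trace =
      ∑ b', (NegSup.equiv (levWeight (F.L : ℝ) ((F.P K).eta k) (bondLevLit F Ω k) 3) (Matrix (Fin N) (Fin N) ℂ) Kc b' *
        flat115 (M (single115 b (1 : Matrix (Fin N) (Fin N) ℂ))) b').trace := by
  rw [transCur_apply, ← tauRecCLM_apply, ← mul_one (rhoRec N _), tauRecCLM_rhoRec_mul, colFun_apply]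
  simp only [tauRecCLM_apply]

/-- **`(MᵗK)(b)` IS TRACELESS WHEN `M` KILLS THE SCALAR DIRECTION `δ_b·1`.** [cite: Balaban1985Variational, (85) p.291, (88)–(89) p.291] -/
theorem trace_transCur_apply_eq_zero_of_apply_single {M : Space115Lit F N K k Ω U₀ →L[ℂ] Space115Lit F N K k Ω U₀} (Kc : NegSizeLit F N K k Ω 3)
    {b : Bond (F.P K).d (fun _ => (F.P K).sitesPerDir 0)} (hM : M (single115 b (1 : Matrix (Fin N) (Fin N) ℂ)) = 0) :
    (NegSup.equiv (levWeight (F.L : ℝ) ((F.P K).eta k) (bondLevLit F Ω k) 3) (Matrix (Fin N) (Fin N) ℂ) (transCur (rhoRec N) (tauRecCLM N) M Kc) b).trace = 0 := by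
  rw [trace_transCur_apply, hM, map_zero]
  simp

/-- **`(MᵗK)(b)` HAS THE TRACE OF `K(b)` WHEN `M` FIXES THE SCALAR DIRECTION `δ_b·1`.** [cite: Balaban1985Variational, (90) p.291] -/
theorem trace_transCur_apply_of_apply_single_eq_self {M : Space115Lit F N K k Ω U₀ →L[ℂ] Space115Lit F N K k Ω U₀} (Kc : NegSizeLit F N K k Ω 3)
    {b : Bond (F.P K).d (fun _ => (F.P K).sitesPerDir 0)} (hM : M (single115 b (1 : Matrix (Fin N) (Fin N) ℂ)) = single115 b 1) :
    (NegSup.equiv (levWeight (F.L : ℝ) ((F.P K).eta k) (bondLevLit F Ω k) 3) (Matrix (Fin N) (Fin N) ℂ) (transCur (rhoRec N) (tauRecCLM N) M Kc) b).trace =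
      (NegSup.equiv (levWeight (F.L : ℝ) ((F.P K).eta k) (bondLevLit F Ω k) 3) (Matrix (Fin N) (Fin N) ℂ) Kc b).trace := by
  classical
  rw [trace_transCur_apply, hM, flat115_single115, Finset.sum_eq_single b]
  · rw [Pi.single_eq_same, mul_one]
  · intro b' _ hb'
    rw [Pi.single_eq_of_ne hb', mul_zero, Matrix.trace_zero]
  · intro h; exact absurd (Finset.mem_univ b) h

/-- The one-bond scalar direction `δ_b·1` is killed by the traceless projection `P`. [cite: Balaban1985Variational, (51) p.286, (90) p.291] -/
theorem slProjLit_single115_one [NeZero N] (b : Bond (F.P K).d (fun _ => (F.P K).sitesPerDir 0)) :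
    slProjLit F N K k Ω U₀ (single115 b (1 : Matrix (Fin N) (Fin N) ℂ)) = 0 := by
  classical
  refine slProjLit_eq_zero_of_scalar F N K k Ω U₀ fun b' => ?_
  by_cases h : b' = b
  · subst h
    exact ⟨1, by rw [← flat115_apply, flat115_single115, Pi.single_eq_same, one_smul]⟩
  · exact ⟨0, by rw [← flat115_apply, flat115_single115, Pi.single_eq_of_ne h, zero_smul]⟩

end Trans

/-! ## §4  `W₁`, `W₃`, `W₂` at def-Y's letters vs the trace -/

section W

variable (F : T4Family) (N : ℕ) [NeZero N] (K : ℕ) (k : ℕ) (Ω : ℕ → Set (Site (F.P K) 0)) (U₀ : GaugeField (F.P K) 0 (SU N))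
  [Fact (0 < (F.L : ℝ))] [Fact (0 < (F.P K).eta k)] [Fact (0 < c0Rec F K k)] [Fact (∀ c, 0 < wBRec F K k c)] {a : ℝ}
  (hposb : ∀ x, x ≠ 0 → 0 < RCLike.re ⟪x, laplaceAOfRecord F N k U₀ (QOfRecord F N k U₀) (QflatOfRecord F N k) a x⟫_ℂ)
  (hQ : Function.Surjective (QOfRecord F N k U₀)) (levB : PBond (F.P K) k → ℕ) {b C₂ c₄ aC εC : ℝ}
  {Gp : SiteL2K ℂ (F.P K).d (fun _ => (F.P K).sitesPerDir 0) (c0Rec F K k) (WRec N) →ₗ[ℂ]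
    SiteL2K ℂ (F.P K).d (fun _ => (F.P K).sitesPerDir 0) (c0Rec F K k) (WRec N)}
  (RC : Regime (H1OfRecordAtBgFlat F N K k Ω U₀ levB a hposb hQ) 0 (CslOfRecord F N K k Ω U₀ levB) b 0 C₂ c₄ 0 aC εC)

include RC in
/-- ★★ **(85): `W₁(A′) = −𝔇₃*(A′)H*J` IS TRACELESS-VALUED AT EVERY `N`, FOR EVERY CURRENT `J`**, `‖A′‖ < a_C` (regime ∕ `Prop4Hyp` displayed): the derivative `D(HD₃)(A′)` kills the scalar
directions `δ_b·1` (✓`fderiv_E3OfRecord_apply_eq_zero`). [cite: Balaban1985Variational, (85) p.291, (51) p.286] -/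
theorem trace_W1OfRecord_eq_zero (hP : Prop4Hyp (CslOfRecord F N K k Ω U₀ levB) C₂ c₄) (J : NegSizeLit F N K k Ω 3) {A' : Space115Lit F N K k Ω U₀} (hn : ‖A'‖ < aC)
    (bd : Bond (F.P K).d (fun _ => (F.P K).sitesPerDir 0)) :
    (NegSup.equiv (levWeight (F.L : ℝ) ((F.P K).eta k) (bondLevLit F Ω k) 3) (Matrix (Fin N) (Fin N) ℂ)
      (W1 (rhoRec N) (tauRecCLM N) (H1OfRecordAtBgFlat F N K k Ω U₀ levB a hposb hQ) (CslOfRecord F N K k Ω U₀ levB) εC J A') bd).trace = 0 := by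
  rw [W1, NegSup.equiv_neg, Pi.neg_apply, Matrix.trace_neg, neg_eq_zero]
  exact trace_transCur_apply_eq_zero_of_apply_single F N K k Ω U₀ J
    (fderiv_E3OfRecord_apply_eq_zero F N K k Ω U₀ levB hposb hQ RC hP (slProjLit_single115_one F N K k Ω U₀ bd) hn)

include RC in
/-- ★★ **(89): `W₃(A′) = 𝔇*(A′)H*Δ_π HD(A′)` IS TRACELESS-VALUED AT EVERY `N`**, `‖A′‖ < a_C` (`D(HD)(A′)` kills `δ_b·1`, ✓`fderiv_EmapOfRecord_apply_eq_zero`).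
[cite: Balaban1985Variational, (89) p.291, (51) p.286] -/
theorem trace_W3OfRecord_eq_zero (hP : Prop4Hyp (CslOfRecord F N K k Ω U₀ levB) C₂ c₄) {A' : Space115Lit F N K k Ω U₀} (hn : ‖A'‖ < aC)
    (bd : Bond (F.P K).d (fun _ => (F.P K).sitesPerDir 0)) :
    (NegSup.equiv (levWeight (F.L : ℝ) ((F.P K).eta k) (bondLevLit F Ω k) 3) (Matrix (Fin N) (Fin N) ℂ)
      (W3 (rhoRec N) (tauRecCLM N) (H1OfRecordAtBgFlat F N K k Ω U₀ levB a hposb hQ) (CslOfRecord F N K k Ω U₀ levB) εC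
        (DeltaPiCurOfRecord F N K k Ω U₀ Gp (QflatOfRecord F N k)) A') bd).trace = 0 := by
  rw [W3]
  exact trace_transCur_apply_eq_zero_of_apply_single F N K k Ω U₀ _
    (fderiv_EmapOfRecord_apply_eq_zero F N K k Ω U₀ levB hposb hQ RC hP (slProjLit_single115_one F N K k Ω U₀ bd) hn)

include RC in
/-- **(88): `W₂(A′) = −(Δ_π HD(A′) + 𝔇*(A′)H*Δ_π A′)` IS TRACELESS-VALUED** at every `N` whenever `HD(A′)` is traceless-presented and `G′`, `Δ(U₀)` commute with `S` (displayed), `‖A′‖ < a_C`.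
[cite: Balaban1985Variational, (88) p.291, (51) p.286] -/
theorem trace_W2OfRecord_eq_zero (hP : Prop4Hyp (CslOfRecord F N K k Ω U₀ levB) C₂ c₄) (hGp : ∀ s, Gp (scalPartW N _ s) = scalPartW N _ (Gp s))
    (hΔ : ∀ x, hessOpOfRecord F N k U₀ (scalPartW N _ x) = scalPartW N _ (hessOpOfRecord F N k U₀ x)) {A' : Space115Lit F N K k Ω U₀} (hn : ‖A'‖ < aC)
    (hE : ∀ b', (JetSup.equiv _ _ (nabla115 ((F.P K).eta k) (unitsOfRecord F N U₀))
      (Emap (H1OfRecordAtBgFlat F N K k Ω U₀ levB a hposb hQ) (CslOfRecord F N K k Ω U₀ levB) εC A') b').trace = 0)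
    (bd : Bond (F.P K).d (fun _ => (F.P K).sitesPerDir 0)) :
    (NegSup.equiv (levWeight (F.L : ℝ) ((F.P K).eta k) (bondLevLit F Ω k) 3) (Matrix (Fin N) (Fin N) ℂ)
      (W2 (rhoRec N) (tauRecCLM N) (H1OfRecordAtBgFlat F N K k Ω U₀ levB a hposb hQ) (CslOfRecord F N K k Ω U₀ levB) εC
        (DeltaPiCurOfRecord F N K k Ω U₀ Gp (QflatOfRecord F N k)) A') bd).trace = 0 := by
  rw [W2, NegSup.equiv_neg, Pi.neg_apply, Matrix.trace_neg, neg_eq_zero, NegSup.equiv_add, Pi.add_apply, Matrix.trace_add,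
    trace_DeltaPiCurOfRecord_eq_zero F N K k Ω U₀ hGp hΔ hE bd,
    trace_transCur_apply_eq_zero_of_apply_single F N K k Ω U₀ _
      (fderiv_EmapOfRecord_apply_eq_zero F N K k Ω U₀ levB hposb hQ RC hP (slProjLit_single115_one F N K k Ω U₀ bd) hn), add_zero]

end W

section WTwo

variable (F : T4Family) (K : ℕ) (k : ℕ) (Ω : ℕ → Set (Site (F.P K) 0)) (U₀ : GaugeField (F.P K) 0 (SU 2))
  [Fact (0 < (F.L : ℝ))] [Fact (0 < (F.P K).eta k)] [Fact (0 < c0Rec F K k)] [Fact (∀ c, 0 < wBRec F K k c)] {a : ℝ}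
  (hposb : ∀ x, x ≠ 0 → 0 < RCLike.re ⟪x, laplaceAOfRecord F 2 k U₀ (QOfRecord F 2 k U₀) (QflatOfRecord F 2 k) a x⟫_ℂ)
  (hQ : Function.Surjective (QOfRecord F 2 k U₀)) (levB : PBond (F.P K) k → ℕ) {b C₂ c₄ aC εC : ℝ}
  {Gp : SiteL2K ℂ (F.P K).d (fun _ => (F.P K).sitesPerDir 0) (c0Rec F K k) (WRec 2) →ₗ[ℂ]
    SiteL2K ℂ (F.P K).d (fun _ => (F.P K).sitesPerDir 0) (c0Rec F K k) (WRec 2)}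
  (RC : Regime (H1OfRecordAtBgFlat F 2 K k Ω U₀ levB a hposb hQ) 0 (CslOfRecord F 2 K k Ω U₀ levB) b 0 C₂ c₄ 0 aC εC)
  (hCreal : ∀ A : Space115Lit F 2 K k Ω U₀,
    ((JetSup.equiv _ _ (nabla115 ((F.P K).eta k) (unitsOfRecord F 2 U₀))).symm
        (star (JetSup.equiv _ _ (nabla115 ((F.P K).eta k) (unitsOfRecord F 2 U₀)) A)) : Space115Lit F 2 K k Ω U₀) = A →
    ‖A‖ ≤ εC + aC → ((NegSup.equiv _ _).symm (star (NegSup.equiv _ _ (CslOfRecord F 2 K k Ω U₀ levB A))) :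
      NegSize (F.L : ℝ) ((F.P K).eta k) levB 0 (Matrix (Fin 2) (Fin 2) ℂ)) = CslOfRecord F 2 K k Ω U₀ levB A)
  (hCtr : ∀ A : Space115Lit F 2 K k Ω U₀,
    ((JetSup.equiv _ _ (nabla115 ((F.P K).eta k) (unitsOfRecord F 2 U₀))).symm
        (star (JetSup.equiv _ _ (nabla115 ((F.P K).eta k) (unitsOfRecord F 2 U₀)) A)) : Space115Lit F 2 K k Ω U₀) = A →
    (∀ b, (JetSup.equiv _ _ (nabla115 ((F.P K).eta k) (unitsOfRecord F 2 U₀)) A b).trace = 0) →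
    ‖A‖ ≤ εC + aC → ∀ c, (NegSup.equiv _ _ (CslOfRecord F 2 K k Ω U₀ levB A) c).trace = 0)

include RC hCreal hCtr in
set_option maxHeartbeats 800000 in
/-- ★★ **(88) AT `N = 2`: `W₂(A′)` IS TRACELESS-VALUED for Hermitian traceless `A′` with `‖A′‖ < a_C`** and `G′` commuting with `S` (guard; Sect. C regime, `Prop4Hyp`, `hCreal`, `hCtr` displayed;
`HD(A′)` traceless-presented by ✓`trace_equiv_EmapOfRecord_eq_zero_two`). [cite: Balaban1985Variational, (88) p.291, (51) p.286] -/
theorem trace_W2OfRecord_eq_zero_two (h : SmallBelow (avOfRecord F 2 K) k U₀) (hP : Prop4Hyp (CslOfRecord F 2 K k Ω U₀ levB) C₂ c₄)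
    (hGp : ∀ s, Gp (scalPartW 2 _ s) = scalPartW 2 _ (Gp s)) {A' : Space115Lit F 2 K k Ω U₀}
    (hA' : ((JetSup.equiv _ _ (nabla115 ((F.P K).eta k) (unitsOfRecord F 2 U₀))).symm
      (star (JetSup.equiv _ _ (nabla115 ((F.P K).eta k) (unitsOfRecord F 2 U₀)) A')) : Space115Lit F 2 K k Ω U₀) = A')
    (hA'tr : ∀ b', (JetSup.equiv _ _ (nabla115 ((F.P K).eta k) (unitsOfRecord F 2 U₀)) A' b').trace = 0) (hn : ‖A'‖ < aC)
    (bd : Bond (F.P K).d (fun _ => (F.P K).sitesPerDir 0)) :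
    (NegSup.equiv (levWeight (F.L : ℝ) ((F.P K).eta k) (bondLevLit F Ω k) 3) (Matrix (Fin 2) (Fin 2) ℂ)
      (W2 (rhoRec 2) (tauRecCLM 2) (H1OfRecordAtBgFlat F 2 K k Ω U₀ levB a hposb hQ) (CslOfRecord F 2 K k Ω U₀ levB) εC
        (DeltaPiCurOfRecord F 2 K k Ω U₀ Gp (QflatOfRecord F 2 k)) A') bd).trace = 0 :=
  trace_W2OfRecord_eq_zero F 2 K k Ω U₀ hposb hQ levB RC hP hGp (fun x => (LinearMap.congr_fun (scalPartW_comp_hessOpOfRecord_two F K k U₀) x).symm) hn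
    (fun b' => trace_equiv_EmapOfRecord_eq_zero_two F k Ω U₀ levB hposb hQ RC hCreal hCtr h hA' hA'tr hn b') bd

end WTwo

end Summit.QuantumFields.YangMills.Theorems.N07W23OfRecordTraceSectors

end
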